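import Literature.AnabelianGeometry.AbsoluteAnabelian.MonoidKummerMapsProp32iGenuineH2
import Literature.AnabelianGeometry.AbsoluteAnabelian.GaloisCyclotomeH2TwoTowers
import HarnessLib

/-!
# [AbsTopIII] Prop 3.2 (i) `H2IsoEq` for the model Kummer theory OF RECORD (`kummerTheoryStd`)

S. Mochizuki, *Topics in absolute anabelian geometry III* (2015), Prop. 3.2 (i) p. 71: the natural isomorphism
`H²(G, μ_Ẑ(M_TM)) ⥲ Ẑ` IS the composite of the Brauer chain to «`H²(G, μ_{ℚ/ℤ}(M_TM)) ⥲ ℚ/ℤ`» followed by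
«applying the functor `Hom(ℚ/ℤ, −)`» — typed as `Prop32iChain.H2IsoEq` (`MonoidKummerMapsSub.lean`, sub-DAG
`plan/L4/SUBDAG-AbsTopIII-Prop32.md` row P32.i.L06; seat abc-iut-w6-d075, follow-on «P32i-H2ISOEQ-STD»).

The tree now carries TWO real `H²`-slots for the model pair `(Π_k ↷ 𝒪_k̄^⊳)`:
(α) abc-iut-L4-t2's `ModelMLFGaloisData.kummerTheoryStd C D R` (`MonoidKummerModelH2.lean`, the Kummer theory OF
RECORD: `coh.H2 = MLFClosure.galH2 C = H²_cont(G_k, Ẑ(1))`, `h2Iso = MLFClosure.galH2EquivZhat` = abc-iut-L4-t11/t16's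
`continuousCohomologyTwoTateModuleEquiv ≫ cohomologyLimitMuEquivZHat`), and (β) `genuineKummerTheory`
(`MonoidKummerMapsProp32iGenuineH2.lean`: `coh.H2 = galCyclotomeH2 Γ_k`, `h2Iso = genuineH2Iso` by the printed
`Hom(ℚ/ℤ, −)`-route), for which the chain statement `H2IsoEq` is proved (`genuineChainStd_neg_h2IsoEq`).
abc-iut-w4-d045's `GaloisCyclotomeH2TwoTowers.lean` supplies the coefficient comparison
`ψ = galCyclotomeToTateModule : μ_Ẑ(G_k) ⥲ Ẑ(1)` (Rmk. 3.2.1) and the LEVELS of (α)'s `h2Iso` along `H²(ψ)`.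
This file closes the seam:

* `ZHatCompletion.eq_of_forall_dvd_repn_sub` / `…_cycLevel_sub` — an element of `Ẑ` is determined by its
  `ℤ/n` (resp. `ℤ/(i+1)!`) coordinates; `toAdd_level_eq_intCast_repn` — abc-iut-L2's level characters
  `ZHatLevel.level n` and abc-iut-w4-d045's representatives `ZHatCompletion.repn n` agree;
* `Prop121vii.galCyclotomeH2EquivGalH2 R : galCyclotomeH2 Γ_k ≃+ galH2` (`= H²(ψ)`, an isomorphism);
* **`Prop121vii.galH2EquivZhat_galCyclotomeH2EquivGalH2`**: `galH2EquivZhat (H²(ψ) y) = genuineH2Iso R endQmodZCanonical y`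
  — the `h2Iso` OF RECORD and the `Hom(ℚ/ℤ, −)`-route `h2Iso` COINCIDE (both have levels `inv_n ∘ H²(cycProj_n)`);
* **`Prop121vii.stdChain R D …` : `Prop32iChain (kummerTheoryStd (MLFClosure.std k) D R)`** — the printed Brauer chain
  over the Kummer theory of record (`homQmodZ := genuineH2HomQmodZEquiv⁻¹ ≫ H²(ψ)`, `endQmodZ := endQmodZCanonical`),
  THE CRITERION `stdChain_h2IsoEq_iff` and **`stdChainStd_neg_h2IsoEq`**: Prop. 3.2 (i)'s `H2IsoEq` HOLDS for the
  Kummer theory of record (orientation `ε = −id`; fails at `ε = id` by the tree's sign, `not_stdChainStd_refl_h2IsoEq`).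

All inputs are kernel theorems of the tree (LCFT: abc-iut-w5-d198/d201/d214, L4-t11/t16/t17/t2, w4-d045, this seat).
HONEST FRAMING: classical; model-level; nothing here bears on [IUTchIII] Cor. 3.12 or takes a side; typed ≠ proved.
-/

noncomputable section

namespace Literature.AnabelianGeometry.AbsoluteAnabelian

open CategoryTheory Field Function
open ProfiniteGrp ProfiniteGrp.ProfiniteCompletion
open Literature.NumberTheory.GaloisRepresentations
open Literature.NumberTheory.GaloisRepresentations.DiscreteGaloisModule
open Literature.AnabelianGeometry.SemiGraphs (ZHat)
open Literature.AnabelianGeometry.EtaleTheta (ZHatLevel.level ZHatLevel.proj ZHatLevel.kerLevel)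

/-! ### `Ẑ` is determined by its levels; `ZHatLevel.level` versus `ZHatCompletion.repn` -/

namespace ZHatCompletion

/-- **`Ẑ` is determined by its `ℤ/n`-coordinates**: two elements of `Ẑ` whose mod-`n` representatives agree
modulo `n` for every `n ≥ 1` are equal (every finite-index subgroup of `ℤ` is an `nℤ`).
[cite: RibesZalesskii2010, Thm 2.7.1] -/
theorem eq_of_forall_dvd_repn_sub {z z' : ZHat}
    (h : ∀ (n : ℕ) [NeZero n], (n : ℤ) ∣ repn n z - repn n z') : z = z' := by
  apply Subtype.ext
  funext N
  haveI : NeZero N.toSubgroup.index := ⟨Subgroup.FiniteIndex.index_ne_zero⟩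
  have h1 := index_dvd_rep_sub_rep (le_level_index N) z
  have h2 := index_dvd_rep_sub_rep (le_level_index N) z'
  rw [index_level] at h1 h2
  have h3 : (N.toSubgroup.index : ℤ) ∣ rep N z - rep N z' := by
    have := (h1.add (h N.toSubgroup.index)).sub h2
    rwa [repn, repn, sub_add_sub_cancel, sub_sub_sub_cancel_right] at this
  rw [val_eq_mk_rep N z, val_eq_mk_rep N z']
  exact (mk_ofAdd_eq_mk_ofAdd_iff N _ _).2 h3

/-- Factorial levels suffice: two elements of `Ẑ` whose `ℤ/(i+1)!`-coordinates agree for every `i` are equal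
(the `(i+1)!` are cofinal for divisibility). [cite: RibesZalesskii2010, Thm 2.7.1] -/
theorem eq_of_forall_dvd_repn_cycLevel_sub {z z' : ZHat}
    (h : ∀ i : ℕ, ((((cycLevel i : ℕ+) : ℕ) : ℤ)) ∣
      @repn ((cycLevel i : ℕ+) : ℕ) ⟨(cycLevel i).ne_zero⟩ z -
        @repn ((cycLevel i : ℕ+) : ℕ) ⟨(cycLevel i).ne_zero⟩ z') : z = z' := by
  refine eq_of_forall_dvd_repn_sub fun n _ => ?_
  haveI : NeZero ((cycLevel (n - 1) : ℕ+) : ℕ) := ⟨(cycLevel (n - 1)).ne_zero⟩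
  have hn : n ∣ ((cycLevel (n - 1) : ℕ+) : ℕ) :=
    dvd_cycLevel_natPred ⟨n, Nat.pos_of_ne_zero (NeZero.ne n)⟩
  have h1 := dvd_repn_sub_repn hn z
  have h2 := dvd_repn_sub_repn hn z'
  have h3 := (Int.natCast_dvd_natCast.2 hn).trans (h (n - 1))
  have := (h3.sub h1).add h2
  rwa [sub_sub_sub_cancel_left, sub_add_sub_cancel] at this

/-- **The two level read-outs of `Ẑ` in the tree agree**: abc-iut-L2's character `ZHatLevel.level n : Ẑ → ℤ/n`
(`CyclotomeZHatAction.lean`) is the class of the representative `repn n` (`MonoidKummerMapsEndQmodZ.lean`).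
[cite: RibesZalesskii2010, Thm 2.7.1] -/
theorem toAdd_level_eq_intCast_repn (n : ℕ+) (z : ZHat) :
    Multiplicative.toAdd (ZHatLevel.level n z) = ((repn (n : ℕ) z : ℤ) : ZMod (n : ℕ)) := by
  haveI : NeZero (n : ℕ) := ⟨n.ne_zero⟩
  -- the two spellings of `nℤ ⊆ ℤ` agree: `kerLevel n ≤ level n`
  have hle : ZHatLevel.kerLevel n ≤ level (n : ℕ) := by
    intro x hx
    have hx' : ((n : ℕ) : ℤ) ∣ Multiplicative.toAdd x := (EtaleTheta.ZHatLevel.mem_kerLevel_iff n x).1 hx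
    have := (ofAdd_mem_level_iff (n : ℕ) (Multiplicative.toAdd x)).2 hx'
    rwa [ofAdd_toAdd] at this
  -- `z.val (kerLevel n) = [r]` with `r ≡ repn n z (mod n)`
  have h1 := index_dvd_rep_sub_rep hle z
  rw [index_level] at h1
  -- `level n z = level n (η r)`
  have h3 : ZHatLevel.proj n z = ZHatLevel.proj n (EtaleTheta.ZHatLevel.eta (rep (ZHatLevel.kerLevel n) z)) := by
    rw [EtaleTheta.ZHatLevel.proj_eta]
    exact val_eq_mk_rep (ZHatLevel.kerLevel n) z
  have h4 : ZHatLevel.level n z =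
      ZHatLevel.level n (EtaleTheta.ZHatLevel.eta (rep (ZHatLevel.kerLevel n) z)) :=
    EtaleTheta.ZHatLevel.proj_eq_iff_level_eq.1 h3
  rw [h4, EtaleTheta.ZHatLevel.level_eta, toAdd_ofAdd]
  exact (ZMod.intCast_eq_intCast_iff_dvd_sub _ _ _).2 (dvd_sub_comm.1 h1)

end ZHatCompletion

/-! ### The two real `h2Iso`'s coincide along `H²(ψ)` -/

namespace Prop121vii

variable (k : Type) [Field k] [ValuativeRel k] [TopologicalSpace k] [IsNonarchimedeanLocalField k] [CharZero k]
variable (R : TorsionReciprocityData k)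

/-- **`H²(ψ) : H²(Γ_k, μ_Ẑ(G_k)) ⥲ H²_cont(G_k, Ẑ(1)) = MLFClosure.galH2`** as an additive equivalence (the composite
of abc-iut-w4-d045's `galCyclotomeH2EquivPowCompatible`, `h2PowCompatibleEquivCohomologyLimit` and abc-iut-L4-t11/t16's
`continuousCohomologyTwoTateModuleEquiv⁻¹`; equal to `H²(galCyclotomeToTateModule)` by
`twoTateModuleEquiv_cohomologyMap_galCyclotomeToTateModule`). [cite: MochizukiAbsTopIII2015, Remark 3.2.1 p.73] -/
def galCyclotomeH2EquivGalH2 :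
    (galCyclotomeH2 (absoluteGaloisGroup k) : Type) ≃+ (MLFClosure.std k).galH2 :=
  (galCyclotomeH2EquivPowCompatible k R.equiv R.equiv_smul).trans
    ((h2PowCompatibleEquivCohomologyLimit k).trans (continuousCohomologyTwoTateModuleEquiv k).symm)

/-- `galCyclotomeH2EquivGalH2` IS `H²(ψ)` on elements. [cite: MochizukiAbsTopIII2015, Remark 3.2.1 p.73] -/
theorem galCyclotomeH2EquivGalH2_apply (y : (galCyclotomeH2 (absoluteGaloisGroup k) : Type)) :
    galCyclotomeH2EquivGalH2 k R y =
      (cohomologyMap (galCyclotomeToTateModule R.equiv R.equiv_smul) 2).hom y := by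
  change (continuousCohomologyTwoTateModuleEquiv k).symm
      (h2PowCompatibleEquivCohomologyLimit k (galCyclotomeH2EquivPowCompatible k R.equiv R.equiv_smul y)) = _
  rw [AddEquiv.symm_apply_eq, twoTateModuleEquiv_cohomologyMap_galCyclotomeToTateModule]

/-- **The `h2Iso` OF RECORD and the `Hom(ℚ/ℤ, −)`-route `h2Iso` coincide**: for `y ∈ H²(Γ_k, μ_Ẑ(G_k))`,
`galH2EquivZhat (H²(ψ) y) = genuineH2Iso R endQmodZCanonical y` in `Ẑ` — both have `ℤ/(i+1)!`-coordinate
`inv_{(i+1)!} (H²(cycProj) y)` (abc-iut-w4-d045's `MLFClosure.toAdd_level_galH2EquivZhat_cohomologyMap`, this seat's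
`natCast_dvd_repn_genuineH2Iso_sub_invLevel`), and `Ẑ` is determined by its levels.
[cite: MochizukiAbsTopIII2015, Proposition 3.2 (i) p.71] -/
theorem galH2EquivZhat_galCyclotomeH2EquivGalH2 (y : (galCyclotomeH2 (absoluteGaloisGroup k) : Type)) :
    (MLFClosure.std k).galH2EquivZhat (galCyclotomeH2EquivGalH2 k R y) =
      genuineH2Iso k R Prop32iChain.endQmodZCanonical y := by
  rw [galCyclotomeH2EquivGalH2_apply]
  apply ULift.ext
  apply Additive.toMul.injective
  refine ZHatCompletion.eq_of_forall_dvd_repn_cycLevel_sub fun i => ?_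
  haveI : NeZero ((cycLevel i : ℕ+) : ℕ) := ⟨(cycLevel i).ne_zero⟩
  -- (α): level `(i+1)!` of the h2Iso of record along `H²(ψ)` is `inv_{(i+1)!} (H²(cycProj) y)`
  have hα := MLFClosure.toAdd_level_galH2EquivZhat_cohomologyMap (MLFClosure.std k) R.equiv R.equiv_smul y
    (cycLevel i)
  rw [ZHatCompletion.toAdd_level_eq_intCast_repn] at hα
  -- (β): the same for the `Hom(ℚ/ℤ, −)`-route, in representative form
  have hβ := natCast_dvd_repn_genuineH2Iso_sub_invLevel k R y i
  have hβ' : ((@ZHatCompletion.repn ((cycLevel i : ℕ+) : ℕ) ⟨(cycLevel i).ne_zero⟩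
      (Additive.toMul (genuineH2Iso k R Prop32iChain.endQmodZCanonical y).down) : ℤ) :
        ZMod ((cycLevel i : ℕ+) : ℕ)) =
      invLevel k ((cycLevel i : ℕ+) : ℕ)
        ((cohomologyMap (cycProj R.equiv R.equiv_smul (cycLevel i)) 2).hom y) := by
    rw [← ZMod.natCast_zmod_val (invLevel k _ _), ← Int.cast_natCast]
    exact (ZMod.intCast_eq_intCast_iff_dvd_sub _ _ _).2 (dvd_sub_comm.1 hβ)
  exact (ZMod.intCast_eq_intCast_iff_dvd_sub _ _ _).1 (hβ'.trans hα.symm)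

/-- The same as an identity of isomorphisms: `galH2EquivZhat = H²(ψ)⁻¹ ≫ genuineH2Iso`.
[cite: MochizukiAbsTopIII2015, Proposition 3.2 (i) p.71] -/
theorem galH2EquivZhat_eq_trans_genuineH2Iso :
    (MLFClosure.std k).galH2EquivZhat =
      (galCyclotomeH2EquivGalH2 k R).symm.trans (genuineH2Iso k R Prop32iChain.endQmodZCanonical) := by
  refine AddEquiv.ext fun x => ?_
  obtain ⟨y, rfl⟩ := (galCyclotomeH2EquivGalH2 k R).surjective x
  rw [galH2EquivZhat_galCyclotomeH2EquivGalH2, AddEquiv.trans_apply, AddEquiv.symm_apply_apply]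

/-! ### The printed chain over the Kummer theory OF RECORD and its `H2IsoEq` -/

variable {k}
variable (D : ModelMLFGaloisData (MLFClosure.std k).k (MLFClosure.std k).K)

/-- **The printed Brauer chain of Prop. 3.2 (i) over abc-iut-L4-t2's Kummer theory of record `kummerTheoryStd`**
(Brauer arrows = `modelChain`'s real carriers; `homQmodZ := genuineH2HomQmodZEquiv⁻¹ ≫ H²(ψ) :
Hom(ℚ/ℤ, H²(Γ_k, μ_{ℚ/ℤ})) ⥲ H²_cont(G_k, Ẑ(1))`; `endQmodZ := endQmodZCanonical`).
[cite: MochizukiAbsTopIII2015, Proposition 3.2 (i) p.71] -/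
def stdChain (Hmid : Type) [AddCommGroup Hmid]
    (e₃ : (continuousCohomology 2 (((units k).quotientInvariants (galUnr k)).toTopRep) : TopModuleCat ℤ) ≃+
      Hmid)
    (e₄ : Hmid ≃+ (continuousCohomology 2
      (ContinuousRep.trivial (absoluteGaloisGroup k ⧸ galUnr k) ℤ ZCoeff.{0}).toTopRep : TopModuleCat ℤ)) :
    Prop32iChain (ModelMLFGaloisData.kummerTheoryStd (MLFClosure.std k) D R) where
  H2muQZ := H2MuQZ k
  H2Mgp := galoisCohomology (units k) 2
  brauerKummer := brauerKummerQZEquiv k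
  H2unr := (continuousCohomology 2 (((units k).quotientInvariants (galUnr k)).toTopRep) : TopModuleCat ℤ)
  inflUnr := inflUnrEquiv k
  H2unrVal := Hmid
  unitsAcyclic := e₃
  H2ZhatZ := (continuousCohomology 2
      (ContinuousRep.trivial (absoluteGaloisGroup k ⧸ galUnr k) ℤ ZCoeff.{0}).toTopRep : TopModuleCat ℤ)
  valGen := e₄
  toQmodZ := toQmodZEquiv k
  homQmodZ := (genuineH2HomQmodZEquiv k R).symm.trans (galCyclotomeH2EquivGalH2 k R)
  endQmodZ := Prop32iChain.endQmodZCanonical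

variable {R D}

/-- The chain composite `invariant` of `stdChain` is that of `modelChain` (same Brauer arrows).
[cite: MochizukiAbsTopIII2015, Proposition 3.2 (i) p.71] -/
theorem stdChain_invariant (Hmid : Type) [AddCommGroup Hmid] (e₃) (e₄) :
    (stdChain R D Hmid e₃ e₄).invariant =
      (modelChain k D Hmid e₃ e₄ Prop32iChain.endQmodZCanonical).invariant :=
  rfl

/-- Abstract core: `E⁻¹ ≫ F ≫ Hom(Q, inv) ≫ eEnd = (F⁻¹ ≫ E)⁻¹ ≫ H ≫ eEnd` with `H` = post-composition with `J`
iff `J = inv`. [cite: MochizukiAbsTopIII2015, Proposition 3.2 (i) p.71] -/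
theorem symm_trans_trans_congr_eq_iff {V W X Q Z : Type} [AddCommGroup V] [AddCommGroup W] [AddCommGroup X]
    [AddCommGroup Q] [AddCommGroup Z] (E : W ≃+ V) (F : W ≃+ (Q →+ X)) (inv J : X ≃+ Q) (eEnd : (Q →+ Q) ≃+ Z)
    (H : (Q →+ X) ≃+ (Q →+ Q)) (hH : ∀ f, H f = J.toAddMonoidHom.comp f) :
    E.symm.trans (F.trans ((AddEquiv.addMonoidHomCongrRight inv).trans eEnd)) =
        (F.symm.trans E).symm.trans (H.trans eEnd) ↔
      J = inv := by
  constructor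
  · intro h
    have key : ∀ f : Q →+ X, inv.toAddMonoidHom.comp f = J.toAddMonoidHom.comp f := by
      intro f
      have h1 := AddEquiv.congr_fun h (E (F.symm f))
      simp only [AddEquiv.trans_apply, AddEquiv.symm_trans_apply, AddEquiv.symm_symm, AddEquiv.symm_apply_apply,
        AddEquiv.apply_symm_apply, hH] at h1
      exact eEnd.injective h1
    ext x
    have h2 := DFunLike.congr_fun (key inv.symm.toAddMonoidHom) (inv x)
    simp only [AddMonoidHom.coe_comp, Function.comp_apply, AddEquiv.coe_toAddMonoidHom,
      AddEquiv.symm_apply_apply] at h2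
    exact h2.symm
  · rintro rfl
    refine AddEquiv.ext fun w => ?_
    simp only [AddEquiv.trans_apply, AddEquiv.symm_trans_apply, AddEquiv.symm_symm, hH]
    rfl

/-- **Prop. 3.2 (i) `H2IsoEq` for the Kummer theory OF RECORD — THE CRITERION**: it holds iff the Brauer-route
composite IS the residue map `invariantQZEquiv` (as for the placeholder and the (β) chains).
[cite: MochizukiAbsTopIII2015, Proposition 3.2 (i) p.71] -/
theorem stdChain_h2IsoEq_iff (Hmid : Type) [AddCommGroup Hmid] (e₃) (e₄) :
    (stdChain R D Hmid e₃ e₄).H2IsoEq ↔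
      (stdChain R D Hmid e₃ e₄).invariant = (invariantQZEquiv k).trans AddEquiv.ulift.symm := by
  unfold Prop32iChain.H2IsoEq
  rw [ModelMLFGaloisData.kummerTheoryStd_h2Iso, galH2EquivZhat_eq_trans_genuineH2Iso k R]
  exact symm_trans_trans_congr_eq_iff (galCyclotomeH2EquivGalH2 k R) (genuineH2HomQmodZEquiv k R)
    ((invariantQZEquiv k).trans AddEquiv.ulift.symm) (stdChain R D Hmid e₃ e₄).invariant
    Prop32iChain.endQmodZCanonical (stdChain R D Hmid e₃ e₄).homInvariant (fun _ => rfl)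

variable (R D)

/-- The chain of record with every Brauer arrow from the tree (`unitsAcyclic := unrValuationH2Equiv`, `valGen := ε`).
[cite: MochizukiAbsTopIII2015, Proposition 3.2 (i) p.71] -/
abbrev stdChainStd
    (ε : (continuousCohomology 2
        (ContinuousRep.trivial (absoluteGaloisGroup k ⧸ galUnr k) ℤ ZCoeff.{0}).toTopRep : TopModuleCat ℤ) ≃+
      (continuousCohomology 2
        (ContinuousRep.trivial (absoluteGaloisGroup k ⧸ galUnr k) ℤ ZCoeff.{0}).toTopRep : TopModuleCat ℤ)) :
    Prop32iChain (ModelMLFGaloisData.kummerTheoryStd (MLFClosure.std k) D R) :=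
  stdChain R D _ (unrValuationH2Equiv k) ε

variable {R D}

/-- **[AbsTopIII] Prop. 3.2 (i) HOLDS for the model Kummer theory OF RECORD**: the `h2Iso` of abc-iut-L4-t2's
all-slots-real `kummerTheoryStd` (`= MLFClosure.galH2EquivZhat`, local class field theory via abc-iut-L4-t11/t16)
IS the composite of the printed Brauer chain to `ℚ/ℤ` followed by «applying the functor `Hom(ℚ/ℤ, −)`» (orientation
`ε = −id` of «`H²(Ẑ, ℤ) ⥲ ℚ/ℤ`», every torsion-reciprocity datum `R`). Model-level; every arrow a kernel theorem.
[cite: MochizukiAbsTopIII2015, Proposition 3.2 (i) p.71] -/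
theorem stdChainStd_neg_h2IsoEq : (stdChainStd R D (AddEquiv.neg _)).H2IsoEq :=
  ((stdChain_h2IsoEq_iff (R := R) (D := D) _ (unrValuationH2Equiv k) (AddEquiv.neg _)).trans
      (eq_invariantQZEquiv_iff_levelwise _)).2
    fun n x => modelChainStd_neg_invariant_of (D := D) Prop32iChain.endQmodZCanonical n x

/-- … and FAILS at abc-iut-L4-t16's orientation `ε = id` (the tree's sign convention, `not_modelChainStd_refl_h2IsoEq`).
[cite: MochizukiAbsTopIII2015, Proposition 3.2 (i) p.71] -/
theorem not_stdChainStd_refl_h2IsoEq : ¬ (stdChainStd R D (AddEquiv.refl _)).H2IsoEq := by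
  intro h
  have h' := (stdChain_h2IsoEq_iff (R := R) (D := D) _ (unrValuationH2Equiv k) (AddEquiv.refl _)).1 h
  exact not_modelChainStd_refl_h2IsoEq (D := D) Prop32iChain.endQmodZCanonical
    ((modelChain_h2IsoEq_iff (k := k) (D := D) _ (unrValuationH2Equiv k) (AddEquiv.refl _)
      Prop32iChain.endQmodZCanonical).2 h')

/-- **Hypothesis-free packaging**: for every `p`-adic local field `k` (char. `0`) and model datum `D`, the printed
chain of Prop. 3.2 (i) over the Kummer theory OF RECORD satisfies `H2IsoEq` for some (indeed every) torsion-reciprocity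
datum `R` (which exists by local class field theory, `nonempty_torsionReciprocityData`).
[cite: MochizukiAbsTopIII2015, Proposition 3.2 (i) p.71] -/
theorem exists_stdChain_h2IsoEq (D : ModelMLFGaloisData (MLFClosure.std k).k (MLFClosure.std k).K) :
    ∃ (R : TorsionReciprocityData k)
      (C : Prop32iChain (ModelMLFGaloisData.kummerTheoryStd (MLFClosure.std k) D R)),
      C.endQmodZ = Prop32iChain.endQmodZCanonical ∧ C.H2IsoEq := by
  obtain ⟨R⟩ := nonempty_torsionReciprocityData k
  exact ⟨R, stdChainStd R D (AddEquiv.neg _), rfl, stdChainStd_neg_h2IsoEq⟩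

end Prop121vii

end Literature.AnabelianGeometry.AbsoluteAnabelian

end
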